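import Literature.MathematicalPhysics.QuantumFieldTheory.Balaban1983to89.B2Sect3AGaussianStep
import Literature.MathematicalPhysics.QuantumFieldTheory.Balaban1983to89.B4Lower18Regular

/-!
# `Balaban1983to89.B2Sect3AReplacement587` — [Balaban1982Higgs2] §3.A p. 587, the «replacement» paragraph after (3.20):
`(G′_k − H′_k)⁻¹ = G′_k⁻¹ + G′_k⁻¹H′_k(G′_k − H′_k)⁻¹`, the norm of the source configuration `≦ O((Lᵏε)⁻²)|Λ₅⁽ᵏ⁾|^{1/2}`,
«replace (G′_k − H′_k)⁻¹ by G′_k⁻¹ and estimate the rest by O((Lᵏε)^κ)|Λ₅⁽ᵏ⁾|», the `F′_k`-terms `≦ O((Lᵏε)^κ)|Λ₅⁽ᵏ⁾|`, and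
*"Thus the integral (3.9) can be estimated by the same integral with H′_k = H″_k = 0, F′_k = F″_k = 0 and multiplied by the
factor exp O((Lᵏε)^κ)|Λ₅⁽ᵏ⁾|"* — PROVED (theorems only; the determinant half (3.18)–(3.20) enters as the displayed hypothesis)

statement-level skeleton of published theorems with citation tags; proofs where landed; nothing here is a claim about the Yang–Mills mass gap

CITATION HEADER.  T. Bałaban, *(Higgs)₂,₃ quantum fields in a finite volume. II. An upper bound*, Commun. Math. Phys.
**86** (1982) 555–594 [Balaban1982Higgs2] (cell paper B2; PDF held `paper:balaban1982-cmp86-higgs23-ii`, journal page =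
PDF page + 554; p. 587 READ AS IMAGE on the ×2 render
`run/shared/lean/pub/pub-balaban/b2b-balaban-ref1/pages/1982-cmp86-higgs23-II/1982-cmp86-higgs23-II-p033-x2.png`).
Unit `lit-balaban-p15` gen 2 (Phase-2 proof seat p15; HOME `run/shared/lean/pub/lit-balaban/`).  SKELETON row **B2.Eq3.20**
((3.13)–(3.20) pp. 586–587), its p. 587 continuation; the sibling `…B2Sect3AGaussianStep` (this seat, p245331) proves
(3.9) = (3.17), (3.15) ⇒ (3.16) and the p. 586 positivity sentence; (3.18) and (3.19)–(3.20) are p04's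
`…B1Eq346DetFactorization.eq318` / `…B2Ineq2103LogDet` and enter the final theorem below AS A HYPOTHESIS in their printed
shape `[det(G′_k − H′_k)]^{−1/2} ≦ (det G′_k)^{−1/2}·exp(O((Lᵏε)^κ)|Λ₅⁽ᵏ⁾|)` — nothing of theirs is restated.  Fold owners
r02 / r14, §3 second reader r13, referee ref-4.

WHAT IS PRINTED (verbatim, p. 587 [PDF 33], after (3.20)): *"The determinant [det(G″_k − H″_k)]^{−1/2} has the identical
properties, so we have the required estimates for both determinants in (3.17). Now we will estimate the last two terms in the
exponent in (3.17). We have (G′_k − H′_k)⁻¹ = G′_k⁻¹ + G′_k⁻¹H′_k(G′_k − H′_k)⁻¹ and the norm of the second operator can be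
estimated as in (3.19). From (3.16), (3.10) and the restrictions on the fields A_k considered on Λ₅⁽ᵏ⁻¹⁾′∩Λ₅⁽ᵏ⁾ᶜ, it follows
that the norm of the configuration Φ′ − Λ₅⁽ᵏ⁾Δ⁽ᵏ⁾(Λ₅⁽ᵏ⁻¹⁾′∩Λ₅⁽ᵏ⁾ᶜ)A_k + f′_k + F′_k can be estimated by
O((Lᵏε)⁻²)|Λ₅⁽ᵏ⁾|^{1/2}. Hence in the terms considered, we can replace the operators (G′_k − H′_k)⁻¹ and (G″_k − H″_k)⁻¹ by
G′_k⁻¹ and G″_k⁻¹, and we can estimate the rest by O((Lᵏε)^κ)|Λ₅⁽ᵏ⁾|. Finally the terms of the form ⟨F′_k, G′_k⁻¹(Φ′ − …)⟩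
and other terms containing one of the functions F′_k, F″_k can be estimated by
O(1)exp(−½δ₁r(Lᵏε))γ₁⁻¹μ₀⁻²(Lᵏε)⁻²O((Lᵏε)⁻²)|Λ₅⁽ᵏ⁾| ≦ O((Lᵏε)^κ)|Λ₅⁽ᵏ⁾|. Thus the integral (3.9) can be estimated by the same
integral with H′_k = H″_k = 0, F′_k = F″_k = 0 and multiplied by the factor exp O((Lᵏε)^κ)|Λ₅⁽ᵏ⁾|."*

THE MODEL = the sibling's (schematic coordinates of `…B1GaussNorm331`; see `…B2Sect3AGaussianStep` module docstring): one
field `A : ι → ℝ` (↤ `A_k↾_{Λ₅⁽ᵏ⁾}`, `|ι|` ↤ `|Λ₅⁽ᵏ⁾| ×` components — the printed `|Λ₅⁽ᵏ⁾|` up to the fixed factor d resp. N),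
`G` (↤ `G′_k`), `H` (↤ `H′_k`) real symmetric matrices, the source `w₀` (↤ `Φ′ − Λ₅Δ⁽ᵏ⁾(Λ₅′∩Λ₅ᶜ)A_k + f′_k`) and `F` (↤ `F′_k`);
norms are Euclidean, written `√(v ⬝ᵥ v)` (no operator norms: «‖H′_k‖ ≦ h» enters as the numerical-radius bound
`|⟨u,H′_ku⟩| ≦ h‖u‖²`, equivalent for symmetric `H′_k` — `abs_bilin_le_of_form_le`, `sqrt_mulVec_self_le_of_form_le` PROVE the
passage to `|⟨u,H′_kv⟩| ≦ h‖u‖‖v‖`, `‖H′_kv‖ ≦ h‖v‖`).  The inputs, displayed as hypotheses with their printed names: (3.11)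
`G′_k ≧ γ(Lᵏε)²I` (γ ↤ γ₁μ₀²), (3.12) `‖H′_k‖ ≦ C_He^{−δ₁r(Lᵏε)}`, (3.16) + the restrictions on `A_k` ⇒ `|w₀(x)| ≦ C_W(Lᵏε)⁻²`,
(3.10) `|F′_k(x)| ≦ C_Fe^{−δ₁r(Lᵏε)}`, and (3.18)–(3.20).

WHAT THIS MODULE PROVES (kernel-checked, 0 `sorry`, standard axioms; THEOREMS ONLY).  §1 `resolvent_identity_587` (the printed
operator identity, for invertible `G`, `G − H`).  §2 Euclidean bookkeeping (coercive-matrix basics `dotProduct_self_nonneg'`,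
`isUnit_det_of_form_ge`, `inv_mulVec_sq_le` are the tree's `B4Lower18Regular`, BY NAME): `abs_dotProduct_le_sqrt` (Cauchy–Schwarz),
`dotProduct_self_le_card_mul_sq`/`sqrt_dotProduct_self_le` («the norm of the configuration … ≦
O((Lᵏε)⁻²)|Λ₅⁽ᵏ⁾|^{1/2}» from a pointwise bound), `abs_bilin_le_of_form_le`, `sqrt_mulVec_self_le_of_form_le` (numerical radius
= norm for symmetric matrices), `sqrt_inv_mulVec_le` (`‖G⁻¹w‖ ≦ ‖w‖/g` from `G ≧ gI`).  §3 the estimates: `rest_bound`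
(`|⟨w,(G−H)⁻¹w⟩ − ⟨w,G⁻¹w⟩| ≦ h/(gg′)·‖w‖²` for `G ≧ gI`, `G − H ≧ g′I`, `‖H‖ ≦ h` — «the rest»), `source_shift_bound`
(`|⟨w₀+F,G⁻¹(w₀+F)⟩ − ⟨w₀,G⁻¹w₀⟩| ≦ (2‖F‖‖w₀‖ + ‖F‖²)/g` — «the terms containing F′_k»), `exponent_replacement`,
`exponent_replacement_sup` (with the pointwise bounds: `≦ (|ι|/2)·[h(W+Φ)²/(gg′) + (2ΦW + Φ²)/g]`), `exponent_replacement_scale`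
(in the printed currencies `g = γℓ²`, `g′ = ½γℓ²`, `h = C_He^{−δ₁r(ℓ)}`, `W = C_Wℓ⁻²`, `Φ = C_Fe^{−δ₁r(ℓ)}`, `ℓ = Lᵏε ≦ 1`:
`≦ (|ι|/2)·K·e^{−δ₁r(ℓ)}ℓ⁻⁸`, K explicit) and `exponent_replacement_pow` (`≦ C_κℓ^κ|ι|` for every κ, by r14's
`B2StepK.rDecayBeatsPowers`).  §4 **`replacement587`**: the final sentence for one field — for every κ there are ℓ₀ > 0 and
C_κ (depending on δ₁, R, r, γ, C_H, C_W, C_F, κ only) such that for 0 < Lᵏε ≦ ℓ₀ the (3.9)-integral with `H′_k, F′_k` is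
`≦` the same integral with `H′_k = 0, F′_k = 0` times `exp((η + C_κ(Lᵏε)^κ)|ι|)`, `η|ι|` being the exponent of the
determinant bound (3.18)–(3.20) supplied as hypothesis (the two-field statement is the product of two instances, cf. the
sibling's `eq317`).
HONEST SCOPE.  (i) As in the sibling, `G′_k, H′_k, Φ′, f′_k, F′_k` are not constructed; (3.10), (3.11), (3.12), (3.16) and
(3.18)–(3.20) are hypotheses, displayed.  (ii) The printed intermediate constant `exp(−½δ₁r)γ₁⁻¹μ₀⁻²(Lᵏε)⁻²O((Lᵏε)⁻²)` is
realised as `e^{−δ₁r(ℓ)}·K·ℓ⁻⁸` (we do not split `e^{−δ₁r}` into halves; both are `≦ O((Lᵏε)^κ)` by the same lemma).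
(iii) «O((Lᵏε)^κ)|Λ₅⁽ᵏ⁾|»: our `|ι|` counts sites × components, a fixed multiple of `|Λ₅⁽ᵏ⁾|`.
-/

noncomputable section

open MeasureTheory Matrix Finset Real
open scoped BigOperators Matrix

namespace Literature.MathematicalPhysics.QuantumFieldTheory.Balaban1983to89.B2Sect3AReplacement587

open B2Sect3AGaussianStep
open B4Lower18Regular (dotProduct_self_nonneg' isUnit_det_of_form_ge inv_mulVec_sq_le)

/-! ## §1 The resolvent identity -/

section Resolvent

variable {ι : Type*} [Fintype ι] [DecidableEq ι]

/-- **p. 587, verbatim**: *"We have (G′_k − H′_k)⁻¹ = G′_k⁻¹ + G′_k⁻¹H′_k(G′_k − H′_k)⁻¹"* (second resolvent identity; `G`,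
`G − H` invertible). [cite: Balaban1982Higgs2, p.587] -/
theorem resolvent_identity_587 (G H : Matrix ι ι ℝ) (hG : IsUnit G.det) (hGH : IsUnit (G - H).det) :
    (G - H)⁻¹ = G⁻¹ + G⁻¹ * H * (G - H)⁻¹ := by
  have h1 : G⁻¹ * G = 1 := nonsing_inv_mul G hG
  have h2 : (G - H) * (G - H)⁻¹ = 1 := mul_nonsing_inv _ hGH
  calc (G - H)⁻¹ = G⁻¹ * G * (G - H)⁻¹ := by rw [h1, Matrix.one_mul]
    _ = G⁻¹ * ((G - H) + H) * (G - H)⁻¹ := by rw [sub_add_cancel]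
    _ = G⁻¹ * (G - H) * (G - H)⁻¹ + G⁻¹ * H * (G - H)⁻¹ := by rw [Matrix.mul_add, Matrix.add_mul]
    _ = G⁻¹ + G⁻¹ * H * (G - H)⁻¹ := by rw [Matrix.mul_assoc, h2, Matrix.mul_one]

end Resolvent

/-! ## §2 Euclidean bookkeeping in `dotProduct` language -/

section Norms

variable {ι : Type*} [Fintype ι]

/-- Cauchy–Schwarz: `|⟨u,v⟩| ≦ ‖u‖‖v‖` (`Finset.sum_mul_sq_le_sq_mul_sq`; `0 ≦ ‖v‖²` is the tree's
`B4Lower18Regular.dotProduct_self_nonneg'`). [folklore] [cite: Balaban1982Higgs2, p.587] -/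
theorem abs_dotProduct_le_sqrt (u v : ι → ℝ) :
    |u ⬝ᵥ v| ≤ Real.sqrt (u ⬝ᵥ u) * Real.sqrt (v ⬝ᵥ v) := by
  rw [← Real.sqrt_mul (dotProduct_self_nonneg' u)]
  refine Real.abs_le_sqrt ?_
  have h := Finset.sum_mul_sq_le_sq_mul_sq Finset.univ u v
  simpa only [dotProduct, pow_two] using h

/-- **«the norm of the configuration … can be estimated by O((Lᵏε)⁻²)|Λ₅⁽ᵏ⁾|^{1/2}»**, squared: a pointwise bound
`|v(x)| ≦ B` gives `‖v‖² ≦ |ι|·B²`. [cite: Balaban1982Higgs2, p.587] -/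
theorem dotProduct_self_le_card_mul_sq (v : ι → ℝ) {B : ℝ} (hB : ∀ x, |v x| ≤ B) :
    v ⬝ᵥ v ≤ Fintype.card ι * B ^ 2 := by
  calc v ⬝ᵥ v = ∑ x, v x ^ 2 := by simp [dotProduct, pow_two]
    _ ≤ ∑ _x : ι, B ^ 2 := Finset.sum_le_sum fun x _ => by
        rw [← sq_abs]; exact pow_le_pow_left₀ (abs_nonneg _) (hB x) 2
    _ = Fintype.card ι * B ^ 2 := by simp [Finset.sum_const, Finset.card_univ]

/-- The same with square roots: `‖v‖ ≦ |ι|^{1/2}·B` (`B ≥ 0`). [cite: Balaban1982Higgs2, p.587] -/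
theorem sqrt_dotProduct_self_le (v : ι → ℝ) {B : ℝ} (hB0 : 0 ≤ B) (hB : ∀ x, |v x| ≤ B) :
    Real.sqrt (v ⬝ᵥ v) ≤ Real.sqrt (Fintype.card ι) * B := by
  calc Real.sqrt (v ⬝ᵥ v) ≤ Real.sqrt (Fintype.card ι * B ^ 2) :=
        Real.sqrt_le_sqrt (dotProduct_self_le_card_mul_sq v hB)
    _ = Real.sqrt (Fintype.card ι) * B := by
        rw [Real.sqrt_mul (Nat.cast_nonneg _), Real.sqrt_sq hB0]

/-- **Numerical radius = norm for symmetric operators** (how «‖H′_k‖ ≦ h» is used): a symmetric `H` with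
`|⟨u,Hu⟩| ≦ h‖u‖²` for all `u` satisfies `|⟨u,Hv⟩| ≦ h‖u‖‖v‖` (polarization `4⟨u′,Hv′⟩ = ⟨u′+v′,H(u′+v′)⟩ −
⟨u′−v′,H(u′−v′)⟩` at `u′ = ‖v‖u`, `v′ = ‖u‖v`). [folklore] [cite: Balaban1982Higgs2, (3.12) p.586, p.587] -/
theorem abs_bilin_le_of_form_le {H : Matrix ι ι ℝ} (hH : H.IsSymm) {h : ℝ}
    (hf : ∀ u, |u ⬝ᵥ (H *ᵥ u)| ≤ h * (u ⬝ᵥ u)) (u v : ι → ℝ) :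
    |u ⬝ᵥ (H *ᵥ v)| ≤ h * Real.sqrt (u ⬝ᵥ u) * Real.sqrt (v ⬝ᵥ v) := by
  set a : ℝ := Real.sqrt (u ⬝ᵥ u) with ha
  set b : ℝ := Real.sqrt (v ⬝ᵥ v) with hb
  have huu := dotProduct_self_nonneg' u
  have hvv := dotProduct_self_nonneg' v
  have ha2 : a ^ 2 = u ⬝ᵥ u := Real.sq_sqrt huu
  have hb2 : b ^ 2 = v ⬝ᵥ v := Real.sq_sqrt hvv
  have ha0 : 0 ≤ a := Real.sqrt_nonneg _
  have hb0 : 0 ≤ b := Real.sqrt_nonneg _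
  rcases eq_or_lt_of_le ha0 with ha' | ha'
  · have hu : u = 0 := dotProduct_self_eq_zero.mp (by rw [← ha2, ← ha']; ring)
    subst hu
    simp [← ha']
  rcases eq_or_lt_of_le hb0 with hb' | hb'
  · have hv : v = 0 := dotProduct_self_eq_zero.mp (by rw [← hb2, ← hb']; ring)
    subst hv
    simp [← hb']
  -- main case: a, b > 0; rescale to equal norms and polarize
  have key : a * b * |u ⬝ᵥ (H *ᵥ v)| ≤ h * (a * b) ^ 2 := by
    have hsym : (a • v) ⬝ᵥ (H *ᵥ (b • u)) = (b • u) ⬝ᵥ (H *ᵥ (a • v)) := by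
      rw [adjointQ_dotProduct, hH.eq, dotProduct_comm]
    have hpol : 4 * ((b • u) ⬝ᵥ (H *ᵥ (a • v)))
        = (b • u + a • v) ⬝ᵥ (H *ᵥ (b • u + a • v)) - (b • u - a • v) ⬝ᵥ (H *ᵥ (b • u - a • v)) := by
      simp only [mulVec_add, mulVec_sub, dotProduct_add, dotProduct_sub, add_dotProduct, sub_dotProduct]
      rw [hsym]; ring
    have h1 := abs_le.mp (hf (b • u + a • v))
    have h2 := abs_le.mp (hf (b • u - a • v))
    have hn : (b • u + a • v) ⬝ᵥ (b • u + a • v) + (b • u - a • v) ⬝ᵥ (b • u - a • v)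
        = 2 * ((b • u) ⬝ᵥ (b • u) + (a • v) ⬝ᵥ (a • v)) := by
      simp only [dotProduct_add, dotProduct_sub, add_dotProduct, sub_dotProduct]
      rw [dotProduct_comm (a • v) (b • u)]; ring
    have hu' : (b • u) ⬝ᵥ (b • u) = b ^ 2 * a ^ 2 := by
      rw [smul_dotProduct, dotProduct_smul, smul_eq_mul, smul_eq_mul, ← ha2]; ring
    have hv' : (a • v) ⬝ᵥ (a • v) = a ^ 2 * b ^ 2 := by
      rw [smul_dotProduct, dotProduct_smul, smul_eq_mul, smul_eq_mul, ← hb2]; ring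
    have hsc : (b • u) ⬝ᵥ (H *ᵥ (a • v)) = a * b * (u ⬝ᵥ (H *ᵥ v)) := by
      rw [mulVec_smul, smul_dotProduct, dotProduct_smul, smul_eq_mul, smul_eq_mul]; ring
    rw [hu', hv'] at hn
    have hpm : h * ((b • u + a • v) ⬝ᵥ (b • u + a • v)) + h * ((b • u - a • v) ⬝ᵥ (b • u - a • v))
        = 4 * (h * (a * b) ^ 2) := by
      rw [← mul_add, hn]; ring
    have hX : |4 * ((b • u) ⬝ᵥ (H *ᵥ (a • v)))| ≤ 4 * (h * (a * b) ^ 2) := by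
      rw [hpol, abs_le]
      constructor <;> linarith [h1.1, h1.2, h2.1, h2.2, hpm]
    rw [abs_mul, hsc, abs_mul, abs_of_pos (mul_pos ha' hb')] at hX
    have h4 : |(4 : ℝ)| = 4 := abs_of_pos (by norm_num)
    rw [h4] at hX
    linarith
  have hab : 0 < a * b := mul_pos ha' hb'
  have := le_of_mul_le_mul_left (by linarith [key] : a * b * |u ⬝ᵥ (H *ᵥ v)| ≤ a * b * (h * a * b)) hab
  linarith

/-- Consequently `‖Hv‖ ≦ h‖v‖` for symmetric `H` with numerical radius `≦ h` (`h ≥ 0`).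
[folklore] [cite: Balaban1982Higgs2, (3.12) p.586, p.587] -/
theorem sqrt_mulVec_self_le_of_form_le {H : Matrix ι ι ℝ} (hH : H.IsSymm) {h : ℝ} (h0 : 0 ≤ h)
    (hf : ∀ u, |u ⬝ᵥ (H *ᵥ u)| ≤ h * (u ⬝ᵥ u)) (v : ι → ℝ) :
    Real.sqrt ((H *ᵥ v) ⬝ᵥ (H *ᵥ v)) ≤ h * Real.sqrt (v ⬝ᵥ v) := by
  set X : ℝ := Real.sqrt ((H *ᵥ v) ⬝ᵥ (H *ᵥ v)) with hXdef
  have hX0 : 0 ≤ X := Real.sqrt_nonneg _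
  have hX2 : X ^ 2 = (H *ᵥ v) ⬝ᵥ (H *ᵥ v) := Real.sq_sqrt (dotProduct_self_nonneg' _)
  have h1 : (H *ᵥ v) ⬝ᵥ (H *ᵥ v) ≤ h * X * Real.sqrt (v ⬝ᵥ v) :=
    (le_abs_self _).trans (abs_bilin_le_of_form_le hH hf (H *ᵥ v) v)
  rcases eq_or_lt_of_le hX0 with hX | hX
  · rw [← hX]; positivity
  · have h2 : X * X ≤ X * (h * Real.sqrt (v ⬝ᵥ v)) := by
      rw [← pow_two, hX2]; linarith
    exact le_of_mul_le_mul_left h2 hX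

/-- **`‖G⁻¹w‖ ≦ ‖w‖/g`** for `G ≧ gI`, `g > 0` (square root of the tree's `B4Lower18Regular.inv_mulVec_sq_le`; how (3.11), resp.
the p. 586 bound `G′_k − H′_k ≧ ½γ₁μ₀²(Lᵏε)²I`, controls the inverses in the exponent of (3.17)).
[folklore] [cite: Balaban1982Higgs2, (3.11) p.585, p.587] -/
theorem sqrt_inv_mulVec_le [DecidableEq ι] {G : Matrix ι ι ℝ} {g : ℝ} (hg : 0 < g)
    (hform : ∀ u, g * (u ⬝ᵥ u) ≤ u ⬝ᵥ (G *ᵥ u)) (w : ι → ℝ) :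
    Real.sqrt ((G⁻¹ *ᵥ w) ⬝ᵥ (G⁻¹ *ᵥ w)) ≤ Real.sqrt (w ⬝ᵥ w) / g := by
  have h := inv_mulVec_sq_le hg hform w
  have h2 : (G⁻¹ *ᵥ w) ⬝ᵥ (G⁻¹ *ᵥ w) ≤ (w ⬝ᵥ w) / g ^ 2 := by
    rw [le_div_iff₀ (by positivity)]; linarith
  calc Real.sqrt ((G⁻¹ *ᵥ w) ⬝ᵥ (G⁻¹ *ᵥ w)) ≤ Real.sqrt ((w ⬝ᵥ w) / g ^ 2) := Real.sqrt_le_sqrt h2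
    _ = Real.sqrt (w ⬝ᵥ w) / g := by rw [Real.sqrt_div' _ (by positivity), Real.sqrt_sq hg.le]

end Norms

/-! ## §3 The replacement estimates -/

section Estimates

variable {ι : Type*} [Fintype ι] [DecidableEq ι]

/-- **«we can replace the operators (G′_k − H′_k)⁻¹ … by G′_k⁻¹ … and we can estimate the rest»**: for symmetric `G ≧ gI`,
`G − H ≧ g′I` (`g, g′ > 0`; p. 586: `g′ = ½g`) and a symmetric `H` with `‖H‖ ≦ h` (numerical-radius form),
`|⟨w,(G − H)⁻¹w⟩ − ⟨w,G⁻¹w⟩| = |⟨G⁻¹w, H(G − H)⁻¹w⟩| ≦ (h/(gg′))‖w‖²` — the resolvent identity and «the norm of the second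
operator … estimated as in (3.19)». [cite: Balaban1982Higgs2, p.587] -/
theorem rest_bound {G H : Matrix ι ι ℝ} (hG : G.IsSymm) (hH : H.IsSymm) {g g' h : ℝ} (hg : 0 < g) (hg' : 0 < g')
    (h0 : 0 ≤ h) (hGform : ∀ u, g * (u ⬝ᵥ u) ≤ u ⬝ᵥ (G *ᵥ u)) (hGHform : ∀ u, g' * (u ⬝ᵥ u) ≤ u ⬝ᵥ ((G - H) *ᵥ u))
    (hHform : ∀ u, |u ⬝ᵥ (H *ᵥ u)| ≤ h * (u ⬝ᵥ u)) (w : ι → ℝ) :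
    |w ⬝ᵥ ((G - H)⁻¹ *ᵥ w) - w ⬝ᵥ (G⁻¹ *ᵥ w)| ≤ h / (g * g') * (w ⬝ᵥ w) := by
  have hdG : IsUnit G.det := isUnit_det_of_form_ge hg hGform
  have hdGH : IsUnit (G - H).det := isUnit_det_of_form_ge hg' hGHform
  have hGiT : G⁻¹ᵀ = G⁻¹ := by rw [transpose_nonsing_inv, hG.eq]
  have hdiff : w ⬝ᵥ ((G - H)⁻¹ *ᵥ w) - w ⬝ᵥ (G⁻¹ *ᵥ w) = (G⁻¹ *ᵥ w) ⬝ᵥ (H *ᵥ ((G - H)⁻¹ *ᵥ w)) := by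
    conv_lhs => rw [resolvent_identity_587 G H hdG hdGH, add_mulVec, dotProduct_add, add_sub_cancel_left, ← mulVec_mulVec,
      ← mulVec_mulVec, adjointQ_dotProduct, hGiT]
  rw [hdiff]
  have hww := dotProduct_self_nonneg' w
  calc |(G⁻¹ *ᵥ w) ⬝ᵥ (H *ᵥ ((G - H)⁻¹ *ᵥ w))|
      ≤ h * Real.sqrt ((G⁻¹ *ᵥ w) ⬝ᵥ (G⁻¹ *ᵥ w)) * Real.sqrt (((G - H)⁻¹ *ᵥ w) ⬝ᵥ ((G - H)⁻¹ *ᵥ w)) :=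
        abs_bilin_le_of_form_le hH hHform _ _
    _ ≤ h * (Real.sqrt (w ⬝ᵥ w) / g) * (Real.sqrt (w ⬝ᵥ w) / g') := by
        gcongr
        · exact sqrt_inv_mulVec_le hg hGform w
        · exact sqrt_inv_mulVec_le hg' hGHform w
    _ = h / (g * g') * (Real.sqrt (w ⬝ᵥ w) * Real.sqrt (w ⬝ᵥ w)) := by ring
    _ = h / (g * g') * (w ⬝ᵥ w) := by rw [Real.mul_self_sqrt hww]

/-- **«the terms of the form ⟨F′_k, G′_k⁻¹(Φ′ − …)⟩ and other terms containing one of the functions F′_k»**: for symmetric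
`G ≧ gI` (`g > 0`), `|⟨w₀ + F, G⁻¹(w₀ + F)⟩ − ⟨w₀, G⁻¹w₀⟩| = |2⟨F, G⁻¹w₀⟩ + ⟨F, G⁻¹F⟩| ≦ (2‖F‖‖w₀‖ + ‖F‖²)/g`.
[cite: Balaban1982Higgs2, p.587] -/
theorem source_shift_bound {G : Matrix ι ι ℝ} (hG : G.IsSymm) {g : ℝ} (hg : 0 < g)
    (hGform : ∀ u, g * (u ⬝ᵥ u) ≤ u ⬝ᵥ (G *ᵥ u)) (w₀ F : ι → ℝ) :
    |(w₀ + F) ⬝ᵥ (G⁻¹ *ᵥ (w₀ + F)) - w₀ ⬝ᵥ (G⁻¹ *ᵥ w₀)|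
      ≤ (2 * (Real.sqrt (F ⬝ᵥ F) * Real.sqrt (w₀ ⬝ᵥ w₀)) + F ⬝ᵥ F) / g := by
  have hGi : G⁻¹.IsSymm := by
    show G⁻¹ᵀ = G⁻¹
    rw [transpose_nonsing_inv, hG.eq]
  have hexp : (w₀ + F) ⬝ᵥ (G⁻¹ *ᵥ (w₀ + F)) - w₀ ⬝ᵥ (G⁻¹ *ᵥ w₀)
      = 2 * (F ⬝ᵥ (G⁻¹ *ᵥ w₀)) + F ⬝ᵥ (G⁻¹ *ᵥ F) := by
    have hsym : w₀ ⬝ᵥ (G⁻¹ *ᵥ F) = F ⬝ᵥ (G⁻¹ *ᵥ w₀) := by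
      rw [adjointQ_dotProduct, hGi.eq, dotProduct_comm]
    rw [mulVec_add, dotProduct_add, add_dotProduct, add_dotProduct, hsym]
    ring
  rw [hexp]
  have hFF := dotProduct_self_nonneg' F
  have h1 : |F ⬝ᵥ (G⁻¹ *ᵥ w₀)| ≤ Real.sqrt (F ⬝ᵥ F) * Real.sqrt (w₀ ⬝ᵥ w₀) / g := by
    calc |F ⬝ᵥ (G⁻¹ *ᵥ w₀)| ≤ Real.sqrt (F ⬝ᵥ F) * Real.sqrt ((G⁻¹ *ᵥ w₀) ⬝ᵥ (G⁻¹ *ᵥ w₀)) :=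
          abs_dotProduct_le_sqrt _ _
      _ ≤ Real.sqrt (F ⬝ᵥ F) * (Real.sqrt (w₀ ⬝ᵥ w₀) / g) :=
          mul_le_mul_of_nonneg_left (sqrt_inv_mulVec_le hg hGform w₀) (Real.sqrt_nonneg _)
      _ = Real.sqrt (F ⬝ᵥ F) * Real.sqrt (w₀ ⬝ᵥ w₀) / g := by ring
  have h2 : |F ⬝ᵥ (G⁻¹ *ᵥ F)| ≤ F ⬝ᵥ F / g := by
    calc |F ⬝ᵥ (G⁻¹ *ᵥ F)| ≤ Real.sqrt (F ⬝ᵥ F) * Real.sqrt ((G⁻¹ *ᵥ F) ⬝ᵥ (G⁻¹ *ᵥ F)) :=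
          abs_dotProduct_le_sqrt _ _
      _ ≤ Real.sqrt (F ⬝ᵥ F) * (Real.sqrt (F ⬝ᵥ F) / g) :=
          mul_le_mul_of_nonneg_left (sqrt_inv_mulVec_le hg hGform F) (Real.sqrt_nonneg _)
      _ = F ⬝ᵥ F / g := by rw [mul_div_assoc', Real.mul_self_sqrt hFF]
  calc |2 * (F ⬝ᵥ (G⁻¹ *ᵥ w₀)) + F ⬝ᵥ (G⁻¹ *ᵥ F)|
      ≤ |2 * (F ⬝ᵥ (G⁻¹ *ᵥ w₀))| + |F ⬝ᵥ (G⁻¹ *ᵥ F)| := abs_add_le _ _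
    _ = 2 * |F ⬝ᵥ (G⁻¹ *ᵥ w₀)| + |F ⬝ᵥ (G⁻¹ *ᵥ F)| := by rw [abs_mul, abs_two]
    _ ≤ 2 * (Real.sqrt (F ⬝ᵥ F) * Real.sqrt (w₀ ⬝ᵥ w₀) / g) + F ⬝ᵥ F / g := by gcongr
    _ = (2 * (Real.sqrt (F ⬝ᵥ F) * Real.sqrt (w₀ ⬝ᵥ w₀)) + F ⬝ᵥ F) / g := by ring

/-- **The change of the exponent of (3.17)** when `(G′_k − H′_k)⁻¹ ↦ G′_k⁻¹` and `F′_k ↦ 0`: with `w = w₀ + F` the full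
source, `|½⟨w,(G − H)⁻¹w⟩ − ½⟨w₀,G⁻¹w₀⟩| ≦ ½[(h/(gg′))‖w‖² + (2‖F‖‖w₀‖ + ‖F‖²)/g]`. [cite: Balaban1982Higgs2, p.587] -/
theorem exponent_replacement {G H : Matrix ι ι ℝ} (hG : G.IsSymm) (hH : H.IsSymm) {g g' h : ℝ} (hg : 0 < g)
    (hg' : 0 < g') (h0 : 0 ≤ h) (hGform : ∀ u, g * (u ⬝ᵥ u) ≤ u ⬝ᵥ (G *ᵥ u))
    (hGHform : ∀ u, g' * (u ⬝ᵥ u) ≤ u ⬝ᵥ ((G - H) *ᵥ u)) (hHform : ∀ u, |u ⬝ᵥ (H *ᵥ u)| ≤ h * (u ⬝ᵥ u))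
    (w₀ F : ι → ℝ) :
    |(1 / 2 : ℝ) * ((w₀ + F) ⬝ᵥ ((G - H)⁻¹ *ᵥ (w₀ + F))) - (1 / 2 : ℝ) * (w₀ ⬝ᵥ (G⁻¹ *ᵥ w₀))|
      ≤ (1 / 2 : ℝ) * (h / (g * g') * ((w₀ + F) ⬝ᵥ (w₀ + F))
          + (2 * (Real.sqrt (F ⬝ᵥ F) * Real.sqrt (w₀ ⬝ᵥ w₀)) + F ⬝ᵥ F) / g) := by
  have h1 := rest_bound hG hH hg hg' h0 hGform hGHform hHform (w₀ + F)
  have h2 := source_shift_bound hG hg hGform w₀ F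
  rw [← mul_sub, abs_mul, abs_of_pos (by norm_num : (0 : ℝ) < 1 / 2)]
  refine mul_le_mul_of_nonneg_left ?_ (by norm_num)
  exact (abs_sub_le _ _ _).trans (add_le_add h1 h2)

/-- The same with the POINTWISE inputs of p. 587: `|w₀(x)| ≦ W` ((3.16) and the restrictions on `A_k`) and `|F(x)| ≦ Φ`
((3.10)) give `|Δexponent| ≦ (|ι|/2)·[h(W + Φ)²/(gg′) + (2ΦW + Φ²)/g]`. [cite: Balaban1982Higgs2, p.587] -/
theorem exponent_replacement_sup {G H : Matrix ι ι ℝ} (hG : G.IsSymm) (hH : H.IsSymm) {g g' h W Φ : ℝ}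
    (hg : 0 < g) (hg' : 0 < g') (h0 : 0 ≤ h) (hW0 : 0 ≤ W) (hΦ0 : 0 ≤ Φ)
    (hGform : ∀ u, g * (u ⬝ᵥ u) ≤ u ⬝ᵥ (G *ᵥ u)) (hGHform : ∀ u, g' * (u ⬝ᵥ u) ≤ u ⬝ᵥ ((G - H) *ᵥ u))
    (hHform : ∀ u, |u ⬝ᵥ (H *ᵥ u)| ≤ h * (u ⬝ᵥ u)) (w₀ F : ι → ℝ) (hW : ∀ x, |w₀ x| ≤ W)
    (hΦ : ∀ x, |F x| ≤ Φ) :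
    |(1 / 2 : ℝ) * ((w₀ + F) ⬝ᵥ ((G - H)⁻¹ *ᵥ (w₀ + F))) - (1 / 2 : ℝ) * (w₀ ⬝ᵥ (G⁻¹ *ᵥ w₀))|
      ≤ (Fintype.card ι : ℝ) / 2 * (h / (g * g') * (W + Φ) ^ 2 + (2 * (Φ * W) + Φ ^ 2) / g) := by
  have h1 := exponent_replacement hG hH hg hg' h0 hGform hGHform hHform w₀ F
  set n : ℝ := (Fintype.card ι : ℝ) with hn
  have hn0 : 0 ≤ n := Nat.cast_nonneg _
  have hww : (w₀ + F) ⬝ᵥ (w₀ + F) ≤ n * (W + Φ) ^ 2 :=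
    dotProduct_self_le_card_mul_sq (w₀ + F) fun x => by
      simpa only [Pi.add_apply] using (abs_add_le (w₀ x) (F x)).trans (add_le_add (hW x) (hΦ x))
  have hF1 : Real.sqrt (F ⬝ᵥ F) ≤ Real.sqrt n * Φ := sqrt_dotProduct_self_le F hΦ0 hΦ
  have hw1 : Real.sqrt (w₀ ⬝ᵥ w₀) ≤ Real.sqrt n * W := sqrt_dotProduct_self_le w₀ hW0 hW
  have hFF : F ⬝ᵥ F ≤ n * Φ ^ 2 := dotProduct_self_le_card_mul_sq F hΦ
  have hprod : Real.sqrt (F ⬝ᵥ F) * Real.sqrt (w₀ ⬝ᵥ w₀) ≤ n * (Φ * W) := by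
    calc Real.sqrt (F ⬝ᵥ F) * Real.sqrt (w₀ ⬝ᵥ w₀) ≤ (Real.sqrt n * Φ) * (Real.sqrt n * W) :=
          mul_le_mul hF1 hw1 (Real.sqrt_nonneg _) (by positivity)
      _ = (Real.sqrt n * Real.sqrt n) * (Φ * W) := by ring
      _ = n * (Φ * W) := by rw [Real.mul_self_sqrt hn0]
  refine h1.trans ?_
  have hgg : 0 ≤ h / (g * g') := div_nonneg h0 (mul_pos hg hg').le
  calc (1 / 2 : ℝ) * (h / (g * g') * ((w₀ + F) ⬝ᵥ (w₀ + F))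
          + (2 * (Real.sqrt (F ⬝ᵥ F) * Real.sqrt (w₀ ⬝ᵥ w₀)) + F ⬝ᵥ F) / g)
      ≤ (1 / 2 : ℝ) * (h / (g * g') * (n * (W + Φ) ^ 2) + (2 * (n * (Φ * W)) + n * Φ ^ 2) / g) := by
        gcongr
    _ = n / 2 * (h / (g * g') * (W + Φ) ^ 2 + (2 * (Φ * W) + Φ ^ 2) / g) := by ring

/-- **In the printed currencies** (`ℓ = Lᵏε ∈ (0,1]`): `g = γℓ²` ((3.11)), `g′ = ½γℓ²` (p. 586), `h = C_He^{−δ₁r(ℓ)}` ((3.12)),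
`W = C_Wℓ⁻²` ((3.16)), `Φ = C_Fe^{−δ₁r(ℓ)}` ((3.10)): `|Δexponent| ≦ (|ι|/2)·K·e^{−δ₁r(ℓ)}·ℓ⁻⁸` with
`K = 2C_H(C_W + C_F)²/γ² + (2C_FC_W + C_F²)/γ` — the printed `O(1)exp(−½δ₁r)γ₁⁻¹μ₀⁻²(Lᵏε)⁻²O((Lᵏε)⁻²)` up to the
bookkeeping of HONEST SCOPE (ii). [cite: Balaban1982Higgs2, p.587] -/
theorem exponent_replacement_scale {G H : Matrix ι ι ℝ} (hG : G.IsSymm) (hH : H.IsSymm)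
    {γ CH CW CF δ₁ R r ℓ : ℝ} (hγ : 0 < γ) (hCH : 0 ≤ CH) (hCW : 0 ≤ CW) (hCF : 0 ≤ CF) (hR : 0 ≤ R)
    (hℓ : 0 < ℓ) (hℓ1 : ℓ ≤ 1)
    (hGform : ∀ u, γ * ℓ ^ 2 * (u ⬝ᵥ u) ≤ u ⬝ᵥ (G *ᵥ u))
    (hGHform : ∀ u, γ / 2 * ℓ ^ 2 * (u ⬝ᵥ u) ≤ u ⬝ᵥ ((G - H) *ᵥ u))
    (hHform : ∀ u, |u ⬝ᵥ (H *ᵥ u)| ≤ CH * Real.exp (-(δ₁ * B2.rFn R r ℓ)) * (u ⬝ᵥ u))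
    (w₀ F : ι → ℝ) (hW : ∀ x, |w₀ x| ≤ CW / ℓ ^ 2)
    (hΦ : ∀ x, |F x| ≤ CF * Real.exp (-(δ₁ * B2.rFn R r ℓ))) (hδ : 0 ≤ δ₁) :
    |(1 / 2 : ℝ) * ((w₀ + F) ⬝ᵥ ((G - H)⁻¹ *ᵥ (w₀ + F))) - (1 / 2 : ℝ) * (w₀ ⬝ᵥ (G⁻¹ *ᵥ w₀))|
      ≤ (Fintype.card ι : ℝ) / 2 * ((2 * CH * (CW + CF) ^ 2 / γ ^ 2 + (2 * CF * CW + CF ^ 2) / γ)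
          * Real.exp (-(δ₁ * B2.rFn R r ℓ)) / ℓ ^ 8) := by
  set E : ℝ := Real.exp (-(δ₁ * B2.rFn R r ℓ)) with hE
  have hE0 : 0 < E := Real.exp_pos _
  have hE1 : E ≤ 1 := by
    rw [hE, Real.exp_le_one_iff, neg_nonpos]
    apply mul_nonneg hδ
    rw [B2.rFn]
    apply mul_nonneg hR
    apply Real.rpow_nonneg
    have := Real.log_nonpos hℓ.le hℓ1
    rw [Real.log_inv]; linarith
  have hℓ2 : 0 < ℓ ^ 2 := by positivity
  have hg : 0 < γ * ℓ ^ 2 := by positivity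
  have hg' : 0 < γ / 2 * ℓ ^ 2 := by positivity
  have h0 : 0 ≤ CH * E := by positivity
  have hW0 : 0 ≤ CW / ℓ ^ 2 := by positivity
  have hΦ0 : 0 ≤ CF * E := by positivity
  have h1 := exponent_replacement_sup hG hH hg hg' h0 hW0 hΦ0 hGform hGHform hHform w₀ F hW hΦ
  refine h1.trans (mul_le_mul_of_nonneg_left ?_ (by positivity))
  -- the scale bookkeeping: everything is ≤ (const)·E·ℓ⁻⁸ on (0,1]
  have hinv1 : 1 ≤ 1 / ℓ ^ 2 := by
    rw [le_div_iff₀ hℓ2]; nlinarith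
  have hℓ4 : 0 < ℓ ^ 4 := by positivity
  have hℓ8 : 0 < ℓ ^ 8 := by positivity
  -- W + Φ ≤ (CW + CF)/ℓ²
  have hsum : CW / ℓ ^ 2 + CF * E ≤ (CW + CF) / ℓ ^ 2 := by
    rw [add_div]
    apply add_le_add le_rfl
    calc CF * E ≤ CF * 1 := mul_le_mul_of_nonneg_left hE1 hCF
      _ ≤ CF * (1 / ℓ ^ 2) := mul_le_mul_of_nonneg_left hinv1 hCF
      _ = CF / ℓ ^ 2 := by ring
  have hsum0 : 0 ≤ CW / ℓ ^ 2 + CF * E := by positivity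
  have hsq : (CW / ℓ ^ 2 + CF * E) ^ 2 ≤ (CW + CF) ^ 2 / ℓ ^ 4 := by
    calc (CW / ℓ ^ 2 + CF * E) ^ 2 ≤ ((CW + CF) / ℓ ^ 2) ^ 2 := pow_le_pow_left₀ hsum0 hsum 2
      _ = (CW + CF) ^ 2 / ℓ ^ 4 := by rw [div_pow]; ring
  -- term 1
  have hcoef : CH * E / (γ * ℓ ^ 2 * (γ / 2 * ℓ ^ 2)) = 2 * CH * E / (γ ^ 2 * ℓ ^ 4) := by
    rw [div_eq_div_iff (by positivity) (by positivity)]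
    ring
  have ht1 : CH * E / (γ * ℓ ^ 2 * (γ / 2 * ℓ ^ 2)) * (CW / ℓ ^ 2 + CF * E) ^ 2
      ≤ 2 * CH * (CW + CF) ^ 2 / γ ^ 2 * E / ℓ ^ 8 := by
    rw [hcoef]
    calc 2 * CH * E / (γ ^ 2 * ℓ ^ 4) * (CW / ℓ ^ 2 + CF * E) ^ 2
        ≤ 2 * CH * E / (γ ^ 2 * ℓ ^ 4) * ((CW + CF) ^ 2 / ℓ ^ 4) :=
          mul_le_mul_of_nonneg_left hsq (by positivity)
      _ = 2 * CH * (CW + CF) ^ 2 / γ ^ 2 * E / ℓ ^ 8 := by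
          field_simp
  -- term 2
  have ht2a : 2 * (CF * E * (CW / ℓ ^ 2)) + (CF * E) ^ 2 ≤ (2 * CF * CW + CF ^ 2) * E / ℓ ^ 2 := by
    have : (CF * E) ^ 2 ≤ CF ^ 2 * E / ℓ ^ 2 := by
      calc (CF * E) ^ 2 = CF ^ 2 * E * E := by ring
        _ ≤ CF ^ 2 * E * 1 := mul_le_mul_of_nonneg_left hE1 (by positivity)
        _ ≤ CF ^ 2 * E * (1 / ℓ ^ 2) := mul_le_mul_of_nonneg_left hinv1 (by positivity)
        _ = CF ^ 2 * E / ℓ ^ 2 := by ring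
    calc 2 * (CF * E * (CW / ℓ ^ 2)) + (CF * E) ^ 2 ≤ 2 * (CF * E * (CW / ℓ ^ 2)) + CF ^ 2 * E / ℓ ^ 2 := by
          linarith
      _ = (2 * CF * CW + CF ^ 2) * E / ℓ ^ 2 := by ring
  have hinv2 : 1 / ℓ ^ 4 ≤ 1 / ℓ ^ 8 := by
    apply one_div_le_one_div_of_le hℓ8
    calc ℓ ^ 8 = ℓ ^ 4 * ℓ ^ 4 := by ring
      _ ≤ ℓ ^ 4 * 1 := mul_le_mul_of_nonneg_left (pow_le_one₀ hℓ.le hℓ1) hℓ4.le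
      _ = ℓ ^ 4 := mul_one _
  have ht2 : (2 * (CF * E * (CW / ℓ ^ 2)) + (CF * E) ^ 2) / (γ * ℓ ^ 2)
      ≤ (2 * CF * CW + CF ^ 2) / γ * E / ℓ ^ 8 := by
    calc (2 * (CF * E * (CW / ℓ ^ 2)) + (CF * E) ^ 2) / (γ * ℓ ^ 2)
        ≤ ((2 * CF * CW + CF ^ 2) * E / ℓ ^ 2) / (γ * ℓ ^ 2) := div_le_div_of_nonneg_right ht2a hg.le
      _ = (2 * CF * CW + CF ^ 2) / γ * E * (1 / ℓ ^ 4) := by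
          field_simp
      _ ≤ (2 * CF * CW + CF ^ 2) / γ * E * (1 / ℓ ^ 8) :=
          mul_le_mul_of_nonneg_left hinv2 (by positivity)
      _ = (2 * CF * CW + CF ^ 2) / γ * E / ℓ ^ 8 := by ring
  calc CH * E / (γ * ℓ ^ 2 * (γ / 2 * ℓ ^ 2)) * (CW / ℓ ^ 2 + CF * E) ^ 2
          + (2 * (CF * E * (CW / ℓ ^ 2)) + (CF * E) ^ 2) / (γ * ℓ ^ 2)
      ≤ 2 * CH * (CW + CF) ^ 2 / γ ^ 2 * E / ℓ ^ 8 + (2 * CF * CW + CF ^ 2) / γ * E / ℓ ^ 8 := add_le_add ht1 ht2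
    _ = (2 * CH * (CW + CF) ^ 2 / γ ^ 2 + (2 * CF * CW + CF ^ 2) / γ) * E / ℓ ^ 8 := by ring

/-- **«≦ O((Lᵏε)^κ)|Λ₅⁽ᵏ⁾|», for every κ**: with r(ℓ) = R(1 + log ℓ⁻¹)ʳ, δ₁, R > 0, r > 1 (r14's `B2StepK.rDecayBeatsPowers`
at exponent κ + 8), for every κ there is `C_κ` such that under the hypotheses of `exponent_replacement_scale`
`|Δexponent| ≦ C_κℓ^κ|ι|` for all `0 < ℓ ≦ 1`. [cite: Balaban1982Higgs2, p.587] -/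
theorem exponent_replacement_pow {γ CH CW CF δ₁ R r : ℝ} (hγ : 0 < γ) (hCH : 0 ≤ CH) (hCW : 0 ≤ CW) (hCF : 0 ≤ CF)
    (hδ : 0 < δ₁) (hR : 0 < R) (hr : 1 < r) (κ : ℝ) :
    ∃ Cκ : ℝ, 0 ≤ Cκ ∧ ∀ ℓ : ℝ, 0 < ℓ → ℓ ≤ 1 →
      ∀ {ι : Type*} [Fintype ι] [DecidableEq ι] (G H : Matrix ι ι ℝ) (w₀ F : ι → ℝ),
        G.IsSymm → H.IsSymm →
        (∀ u, γ * ℓ ^ 2 * (u ⬝ᵥ u) ≤ u ⬝ᵥ (G *ᵥ u)) →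
        (∀ u, γ / 2 * ℓ ^ 2 * (u ⬝ᵥ u) ≤ u ⬝ᵥ ((G - H) *ᵥ u)) →
        (∀ u, |u ⬝ᵥ (H *ᵥ u)| ≤ CH * Real.exp (-(δ₁ * B2.rFn R r ℓ)) * (u ⬝ᵥ u)) →
        (∀ x, |w₀ x| ≤ CW / ℓ ^ 2) → (∀ x, |F x| ≤ CF * Real.exp (-(δ₁ * B2.rFn R r ℓ))) →
        |(1 / 2 : ℝ) * ((w₀ + F) ⬝ᵥ ((G - H)⁻¹ *ᵥ (w₀ + F))) - (1 / 2 : ℝ) * (w₀ ⬝ᵥ (G⁻¹ *ᵥ w₀))|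
          ≤ Cκ * ℓ ^ κ * Fintype.card ι := by
  obtain ⟨C8, hC8⟩ := B2StepK.rDecayBeatsPowers hδ hR hr (κ + 8)
  have hC8pos : 0 < C8 := by
    have h := hC8 1 one_pos le_rfl
    rw [Real.one_rpow, mul_one] at h
    exact (Real.exp_pos _).trans_le h
  set K : ℝ := 2 * CH * (CW + CF) ^ 2 / γ ^ 2 + (2 * CF * CW + CF ^ 2) / γ with hK
  have hK0 : 0 ≤ K := by positivity
  refine ⟨K * C8 / 2, by positivity, fun ℓ hℓ hℓ1 ι _ _ G H w₀ F hGs hHs hG hGH hH hW hΦ => ?_⟩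
  have h1 := exponent_replacement_scale hGs hHs hγ hCH hCW hCF hR.le hℓ hℓ1 hG hGH hH w₀ F hW hΦ hδ.le
  refine h1.trans ?_
  have h2 : Real.exp (-(δ₁ * B2.rFn R r ℓ)) / ℓ ^ 8 ≤ C8 * ℓ ^ κ := by
    have h := hC8 ℓ hℓ hℓ1
    rw [div_le_iff₀ (by positivity)]
    calc Real.exp (-(δ₁ * B2.rFn R r ℓ)) ≤ C8 * ℓ ^ (κ + 8) := h
      _ = C8 * ℓ ^ κ * ℓ ^ 8 := by
          rw [Real.rpow_add hℓ, show ((8 : ℝ)) = ((8 : ℕ) : ℝ) by norm_num, Real.rpow_natCast]; ring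
  have hn : 0 ≤ (Fintype.card ι : ℝ) := Nat.cast_nonneg _
  calc (Fintype.card ι : ℝ) / 2 * (K * Real.exp (-(δ₁ * B2.rFn R r ℓ)) / ℓ ^ 8)
      = (Fintype.card ι : ℝ) / 2 * K * (Real.exp (-(δ₁ * B2.rFn R r ℓ)) / ℓ ^ 8) := by ring
    _ ≤ (Fintype.card ι : ℝ) / 2 * K * (C8 * ℓ ^ κ) := mul_le_mul_of_nonneg_left h2 (by positivity)
    _ = K * C8 / 2 * ℓ ^ κ * Fintype.card ι := by ring

end Estimates

/-! ## §4 «Thus the integral (3.9) can be estimated by the same integral with H′_k = H″_k = 0, F′_k = F″_k = 0 and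
multiplied by the factor exp O((Lᵏε)^κ)|Λ₅⁽ᵏ⁾|» — one field -/

section Final

-- universe 0 for the index types: the sibling's `sentence586_of_norm312` (like r14's `B2StepK.KernelBound2109`) is
-- stated for `Y : Type`.
variable {ι J ιE : Type} [Fintype ι] [Fintype J] [Fintype ιE] [DecidableEq ι] [DecidableEq J]

/-- The (3.9)-integral of one field WITH `H′_k = 0`, `F′_k = 0`, in closed form (the sibling's `integral39_field` at
`H = 0`, `F = 0`): `∫dA exp[−½Σc(E − QA)² − ½⟨A,ΔA⟩ − ⟨Aext,DA⟩ + ⟨f,A⟩] = √(2π)^{|ι|}/√det G₀ · exp(−½Σc·E² +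
½⟨w₀,G₀⁻¹w₀⟩)`, `G₀ = QᵀCQ + Δ`, `w₀ = Qᵀ(c·E) − DᵀAext + f`. [cite: Balaban1982Higgs2, (3.17) p.586, p.587] -/
theorem integral39_field_replaced (c E : J → ℝ) (Q : Matrix J ι ℝ) (Δ : Matrix ι ι ℝ) (Aext : ιE → ℝ)
    (D : Matrix ιE ι ℝ) (f : ι → ℝ) (hG : (Qᵀ * (diagonal c * Q) + Δ).PosDef) :
    ∫ A : ι → ℝ, Real.exp (-(1 / 2 : ℝ) * ∑ j, c j * (E j - (Q *ᵥ A) j) ^ 2 - (1 / 2 : ℝ) * (A ⬝ᵥ (Δ *ᵥ A))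
        - Aext ⬝ᵥ (D *ᵥ A) + f ⬝ᵥ A)
      = Real.sqrt (2 * π) ^ Fintype.card ι / Real.sqrt (Qᵀ * (diagonal c * Q) + Δ).det
          * Real.exp (-(1 / 2 : ℝ) * ∑ j, c j * E j ^ 2
              + (1 / 2 : ℝ) * ((Qᵀ *ᵥ (c * E) - Dᵀ *ᵥ Aext + f)
                  ⬝ᵥ (Qᵀ * (diagonal c * Q) + Δ)⁻¹ *ᵥ (Qᵀ *ᵥ (c * E) - Dᵀ *ᵥ Aext + f))) := by
  have hG' : (Qᵀ * (diagonal c * Q) + Δ - 0).PosDef := by rwa [sub_zero]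
  have h := integral39_field c E Q Δ 0 Aext D f 0 hG'
  simp only [zero_mulVec, dotProduct_zero, mul_zero, add_zero, zero_dotProduct, sub_zero] at h
  exact h

/-- **p. 587, the concluding sentence, one field**: *"Thus the integral (3.9) can be estimated by the same integral with
H′_k = H″_k = 0, F′_k = F″_k = 0 and multiplied by the factor exp O((Lᵏε)^κ)|Λ₅⁽ᵏ⁾|."*  PRECISELY: for the printed ranges
δ₁, R > 0, r > 1 of r(ε), the constant γ > 0 of (3.11) (↤ γ₁μ₀²) and the O(1)'s `C_H, C_W, C_F ≥ 0` of (3.12), (3.16), (3.10),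
and every κ, there are `ℓ₀ > 0` and `C_κ ≥ 0` (depending on these data only) such that for every scale `0 < ℓ = Lᵏε ≦ ℓ₀`,
all finite index types and all data of (3.9) in the sibling's coordinates (`G₀ = QᵀCQ + Δ` ↤ `G′_k`, `w₀ = Qᵀ(c·E) −
DᵀAext + f` ↤ `Φ′ − Λ₅Δ(Λ₅′∩Λ₅ᶜ)A_k + f′_k`) with `Δ`, `H` symmetric, (3.11) `G₀ ≧ γℓ²I`, (3.12) `|⟨u,Hu⟩| ≦ C_He^{−δ₁r(ℓ)}‖u‖²`,
`|w₀(x)| ≦ C_Wℓ⁻²`, (3.10) `|F(x)| ≦ C_Fe^{−δ₁r(ℓ)}` and the determinant bound (3.18)–(3.20) in the shape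
`[det(G₀ − H)]^{−1/2} ≦ (det G₀)^{−1/2}e^{η|ι|}`:
`∫dA e^{(3.9)-exponent} ≦ (∫dA e^{(3.9)-exponent with H = 0, F = 0}) · exp((η + C_κℓ^κ)|ι|)`.
[cite: Balaban1982Higgs2, p.587; (3.9)–(3.11) p.585; (3.12), (3.16)–(3.18) p.586; (3.19)–(3.20) p.587] -/
theorem replacement587 {δ₁ R r γ CH CW CF : ℝ} (hδ : 0 < δ₁) (hR : 0 < R) (hr : 1 < r) (hγ : 0 < γ) (hCH : 0 ≤ CH)
    (hCW : 0 ≤ CW) (hCF : 0 ≤ CF) (κ : ℝ) :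
    ∃ ℓ₀ : ℝ, 0 < ℓ₀ ∧ ∃ Cκ : ℝ, 0 ≤ Cκ ∧ ∀ ℓ : ℝ, 0 < ℓ → ℓ ≤ ℓ₀ →
      ∀ {ι J ιE : Type} [Fintype ι] [Fintype J] [Fintype ιE] [DecidableEq ι] [DecidableEq J]
        (c E : J → ℝ) (Q : Matrix J ι ℝ) (Δ H : Matrix ι ι ℝ) (Aext : ιE → ℝ) (D : Matrix ιE ι ℝ)
        (f F : ι → ℝ) (η : ℝ),
        Δ.IsSymm → H.IsSymm →
        (∀ u, γ * ℓ ^ 2 * (u ⬝ᵥ u) ≤ u ⬝ᵥ ((Qᵀ * (diagonal c * Q) + Δ) *ᵥ u)) →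
        (∀ u, |u ⬝ᵥ (H *ᵥ u)| ≤ CH * Real.exp (-(δ₁ * B2.rFn R r ℓ)) * (u ⬝ᵥ u)) →
        (∀ x, |(Qᵀ *ᵥ (c * E) - Dᵀ *ᵥ Aext + f) x| ≤ CW / ℓ ^ 2) →
        (∀ x, |F x| ≤ CF * Real.exp (-(δ₁ * B2.rFn R r ℓ))) →
        ((Qᵀ * (diagonal c * Q) + Δ - H).det ^ (-(1 / 2 : ℝ))
            ≤ (Qᵀ * (diagonal c * Q) + Δ).det ^ (-(1 / 2 : ℝ)) * Real.exp (η * Fintype.card ι)) →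
        ∫ A : ι → ℝ, Real.exp (-(1 / 2 : ℝ) * ∑ j, c j * (E j - (Q *ᵥ A) j) ^ 2 - (1 / 2 : ℝ) * (A ⬝ᵥ (Δ *ᵥ A))
            - Aext ⬝ᵥ (D *ᵥ A) + f ⬝ᵥ A + (1 / 2 : ℝ) * (A ⬝ᵥ (H *ᵥ A)) + F ⬝ᵥ A)
          ≤ (∫ A : ι → ℝ, Real.exp (-(1 / 2 : ℝ) * ∑ j, c j * (E j - (Q *ᵥ A) j) ^ 2
                - (1 / 2 : ℝ) * (A ⬝ᵥ (Δ *ᵥ A)) - Aext ⬝ᵥ (D *ᵥ A) + f ⬝ᵥ A))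
            * Real.exp ((η + Cκ * ℓ ^ κ) * Fintype.card ι) := by
  obtain ⟨ℓ₀, hℓ₀, h586⟩ := sentence586_of_norm312 hδ hR hr hCH hγ
  obtain ⟨Cκ, hCκ, hpow⟩ := exponent_replacement_pow hγ hCH hCW hCF hδ hR hr κ
  refine ⟨min ℓ₀ 1, lt_min hℓ₀ one_pos, Cκ, hCκ, ?_⟩
  intro ℓ hℓ hℓm ι J ιE _ _ _ _ _ c E Q Δ H Aext D f F η hΔ hHs hG hH hW hF hdet
  have hℓ0 : ℓ ≤ ℓ₀ := hℓm.trans (min_le_left _ _)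
  have hℓ1 : ℓ ≤ 1 := hℓm.trans (min_le_right _ _)
  -- symmetry of G₀ = QᵀCQ + Δ
  have hG0s : (Qᵀ * (diagonal c * Q) + Δ).IsSymm := by
    have h1 : (Qᵀ * (diagonal c * Q)).IsSymm := by
      show (Qᵀ * (diagonal c * Q))ᵀ = Qᵀ * (diagonal c * Q)
      rw [transpose_mul, transpose_mul, transpose_transpose, diagonal_transpose, Matrix.mul_assoc]
    exact h1.add hΔ
  -- p. 586: G₀ − H positive, ≥ ½γℓ²
  obtain ⟨hPD, hGH⟩ := h586 ℓ hℓ hℓ0 (Qᵀ * (diagonal c * Q) + Δ) H hG0s hHs hG hH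
  have hPD0 : (Qᵀ * (diagonal c * Q) + Δ).PosDef :=
    posDef_of_quadForm_lower hG0s (by positivity) hG
  -- the two closed forms (3.17)
  rw [integral39_field c E Q Δ H Aext D f F hPD, integral39_field_replaced c E Q Δ Aext D f hPD0,
    gaussConst_eq_rpow hPD, gaussConst_eq_rpow hPD0]
  -- the exponent replacement
  have hexp := hpow ℓ hℓ hℓ1 (Qᵀ * (diagonal c * Q) + Δ) H (Qᵀ *ᵥ (c * E) - Dᵀ *ᵥ Aext + f) F hG0s hHs hG hGH hH
    hW hF
  set e₁ : ℝ := (1 / 2 : ℝ) * ((Qᵀ *ᵥ (c * E) - Dᵀ *ᵥ Aext + f + F)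
      ⬝ᵥ (Qᵀ * (diagonal c * Q) + Δ - H)⁻¹ *ᵥ (Qᵀ *ᵥ (c * E) - Dᵀ *ᵥ Aext + f + F)) with he₁
  set e₀ : ℝ := (1 / 2 : ℝ) * ((Qᵀ *ᵥ (c * E) - Dᵀ *ᵥ Aext + f)
      ⬝ᵥ (Qᵀ * (diagonal c * Q) + Δ)⁻¹ *ᵥ (Qᵀ *ᵥ (c * E) - Dᵀ *ᵥ Aext + f)) with he₀
  have hle : e₁ ≤ e₀ + Cκ * ℓ ^ κ * Fintype.card ι := by
    have := (abs_le.mp hexp).2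
    rw [he₁, he₀]; linarith
  set κ₀ : ℝ := -(1 / 2 : ℝ) * ∑ j, c j * E j ^ 2 with hκ₀
  set P : ℝ := (2 * π) ^ ((Fintype.card ι : ℝ) / 2) with hP
  have hP0 : 0 ≤ P := by positivity
  set d₁ : ℝ := (Qᵀ * (diagonal c * Q) + Δ - H).det ^ (-(1 / 2 : ℝ)) with hd₁
  set d₀ : ℝ := (Qᵀ * (diagonal c * Q) + Δ).det ^ (-(1 / 2 : ℝ)) with hd₀
  have hd₀0 : 0 ≤ d₀ := Real.rpow_nonneg hPD0.posSemidef.det_nonneg _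
  set n : ℝ := (Fintype.card ι : ℝ) with hn
  have hexp1 : Real.exp (κ₀ + e₁) ≤ Real.exp (κ₀ + e₀) * Real.exp (Cκ * ℓ ^ κ * n) := by
    rw [← Real.exp_add, Real.exp_le_exp]
    linarith
  have hrhs : P * d₀ * Real.exp (κ₀ + e₀) * Real.exp ((η + Cκ * ℓ ^ κ) * n)
      = P * (d₀ * Real.exp (η * n)) * (Real.exp (κ₀ + e₀) * Real.exp (Cκ * ℓ ^ κ * n)) := by
    rw [show (η + Cκ * ℓ ^ κ) * n = η * n + Cκ * ℓ ^ κ * n by ring, Real.exp_add (η * n) (Cκ * ℓ ^ κ * n)]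
    ring
  -- assemble: P d₁ exp(κ₀ + e₁) ≤ P (d₀ e^{ηn}) (exp(κ₀ + e₀) e^{Cκ ℓ^κ n})
  rw [hrhs]
  calc P * d₁ * Real.exp (κ₀ + e₁) ≤ P * (d₀ * Real.exp (η * n)) * Real.exp (κ₀ + e₁) :=
        mul_le_mul_of_nonneg_right (mul_le_mul_of_nonneg_left hdet hP0) (Real.exp_pos _).le
    _ ≤ P * (d₀ * Real.exp (η * n)) * (Real.exp (κ₀ + e₀) * Real.exp (Cκ * ℓ ^ κ * n)) :=
        mul_le_mul_of_nonneg_left hexp1 (mul_nonneg hP0 (mul_nonneg hd₀0 (Real.exp_pos _).le))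

end Final

end Literature.MathematicalPhysics.QuantumFieldTheory.Balaban1983to89.B2Sect3AReplacement587
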